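import Summits.BirchSwinnertonDyer.BirchSwinnertonDyer.Theorems.AdditiveKolyvaginRoadLevelSystemsBottomOfRaise
import Summits.BirchSwinnertonDyer.BirchSwinnertonDyer.Theorems.AdditiveKolyvaginRoadAdmissibleRaise
import HarnessLib

/-!
# Route `AdditiveKolyvaginRoad`, crux `LevelKolyvaginSystemsAdditive` (item stmt-BirchSwinnertonDyer-21396, KS′):
# THE BOTTOM CRUX IS A COROLLARY OF THE LEVEL SYSTEMS — at a rank-one ♯ additive frame a level Kolyvagin system yields
# Kolyvagin primitivity, modulo ONLY the named Poitou–Tate fact (the route's DUAL input)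
# (cell `pub/bsd-wall`, lead prover `bsd-wall-akr-p2x` g0, line `birth`; `--supports stmt-BirchSwinnertonDyer-21396`, helper)

WHAT. `kolyvaginPrimitive_of_levelSystem_of_rankOne_of_poitouTate`: at every ♯ additive frame (`p ≥ 5`, `Addv`, `ρ̄` onto,
♠(1)(2), `p ∤ ∏ c_ℓ`, `r_an = 1`, `K` imaginary quadratic with odd `d_K`, Heegner, `L(E^{d_K},1) ≠ 0`, `4N ∣ β² − d_K`,
`p ∤ c_Manin`), complex conjugation `c ≠ 1`, `#Sel_p(E/K) = p` and `poitouTate_selmerStructure_duality K`: every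
`LevelKolyvaginSystemP W K p Dt β ι c` yields `∃ n d, KolSupp n ∧ d.kolyvaginClass ≠ 0` — the conclusion of crux r2
`KolyvaginPrimitiveAdditive` at the frame. Composition of `kolyvaginPrimitive_of_levelSystem_of_rankOne_of_raise`
(`…LevelSystemsBottomOfRaise`) with the PROVED one-prime raising `selQP_raise_of_admQ` (`…AdmissibleRaise`).

CONSEQUENCE FOR THE ROUTE (planner's business): in skeleton v9 of crux r2 (item 21400) the case `s = 1`, served there by
the bottom crux BOT′ (`BottomRankOneAdditive`, item 21397) through `selmerRankOne_of`, is served by KS′ + DUAL.2 instead: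
`KolyvaginPrimitiveAdditive ⇐ P ∧ KS′ ∧ LOC ∧ PublishedDualityInputsAdditiveKoly.2` — BOT′ is no longer needed by the
composition `KolyvaginPrimitiveOfLevelSystemsAdditive` (item 21266).

HONEST FRAMING: one theorem; 0 definitions, 0 named facts, 0 `sorry`; CONDITIONAL on the named PT fact only; closes
nothing (KS′ itself — the existence of the level systems at p² ∣ N — is the open mathematics). BSD is not proved by any
of this.

References: [cite: WZhang2014, Thm. 4.3, Lemma 5.3, Prop. 5.4, Thm. 7.2, Lemma 7.3, §9] [cite: MilneADT2006, Ch. I,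
Thm. 4.10] [cite: GrossLMS1991, §4 (4.4)].
-/

-- single-conjunct summit: `Summit.BirchSwinnertonDyer.BirchSwinnertonDyer.…` repeats the name by design
set_option linter.dupNamespace false

noncomputable section

open scoped Classical

namespace Summit.BirchSwinnertonDyer.BirchSwinnertonDyer.Theorems.AdditiveKoly

open WeierstrassCurve NumberField IsDedekindDomain Field
  Literature.NumberTheory.EllipticCurves Literature.NumberTheory.EllipticCurves.ModularForms
  Literature.NumberTheory.EllipticCurves.Rank1Residual Literature.NumberTheory.GaloisRepresentations
  Literature.NumberTheory.GaloisCohomology Module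

variable (W : WeierstrassCurve ℚ) (K : Type) [Field K] [NumberField K] (p : ℕ)
  [W.IsElliptic] [W.IsGloballyMinimal] [NeZero (W.conductorNorm ℤ)] [Fact p.Prime]
  (c : K ≃ₐ[ℚ] K) [Module (ZMod p) (Vp W K p)]
  (Dt : ModularParametrizationData W (W.conductorNorm ℤ)) (β : ℤ) (ι : K →+* ℂ)

/-- **KOLYVAGIN PRIMITIVITY AT A RANK-ONE ♯ ADDITIVE FRAME FROM A LEVEL KOLYVAGIN SYSTEM, modulo the Poitou–Tate fact only.**
At a ♯ additive frame with complex conjugation `c ≠ 1`, `#Sel_p(E/K) = p` and `poitouTate_selmerStructure_duality K`, every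
level Kolyvagin system produces a square-free product `n` of Kolyvagin primes and a Kolyvagin–Heegner datum `d` of conductor
`n` with `d.kolyvaginClass ≠ 0`. (`…_of_raise` + `selQP_raise_of_admQ`; the compactness of the local absolute Galois groups
is the proved `absoluteGaloisGroup_compactSpace`.) [cite: WZhang2014, Thm. 4.3, Lemma 5.3, Thm. 7.2, Lemma 7.3, §9]
[cite: MilneADT2006, Ch. I, Thm. 4.10] -/
theorem kolyvaginPrimitive_of_levelSystem_of_rankOne_of_poitouTate (h5 : 5 ≤ p) (hadd : Addv W p)
    (hsurj : W.HasSurjectiveModNGaloisRep p)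
    (hsp1 : ∀ (ℓ : ℕ) [Fact ℓ.Prime], W.HasMultiplicativeReductionAtPrime ℓ →
      ¬ p ∣ padicValInt ℓ W.minimalDiscriminantInt)
    (hsp2 : ∃ (ℓ₁ ℓ₂ : ℕ) (_ : Fact ℓ₁.Prime) (_ : Fact ℓ₂.Prime), ℓ₁ ≠ ℓ₂ ∧
      W.HasMultiplicativeReductionAtPrime ℓ₁ ∧ W.HasMultiplicativeReductionAtPrime ℓ₂)
    (htam : ¬ p ∣ W.tamagawaProduct) (hr1 : W.analyticRank = 1)
    (hK : IsImaginaryQuadratic K) (hodd : Odd (NumberField.discr K))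
    (hH : SatisfiesHeegnerHypothesis (W.conductorNorm ℤ) K)
    (hL : (W.quadraticTwist (NumberField.discr K : ℚ)).entireLFunction 1 ≠ 0)
    (hβ : (4 * (W.conductorNorm ℤ : ℤ)) ∣ β ^ 2 - NumberField.discr K) (hc : ¬ (p : ℤ) ∣ Dt.c) (hc1 : c ≠ 1)
    (hPT : poitouTate_selmerStructure_duality K)
    (S : LevelKolyvaginSystemP W K p Dt β ι c)
    (hsel : Nat.card (WeierstrassCurve.selmerGroup (W.baseChange K) (p : ℤ)) = p) :
    ∃ (n : ℕ) (d : KolyvaginHeegnerData Dt β ι n),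
      KolyvaginDescent.KolSupp (Zhang2014.IsKolyvaginPrime (W.conductorNorm ℤ) W K p) n ∧
        d.kolyvaginClass (Fact.out : p.Prime) 1 ≠ 0 := by
  haveI : ∀ v : Place K, CompactSpace (absoluteGaloisGroup (Place.Completion v)) := fun v ↦
    absoluteGaloisGroup_compactSpace _
  have hp2 : p ≠ 2 := by omega
  exact kolyvaginPrimitive_of_levelSystem_of_rankOne_of_raise W K p c Dt β ι h5 hadd hsurj hsp1 hsp2 htam hr1 hK hodd
    hH hL hβ hc hc1 (selQP_raise_of_admQ W K p hK hp2 hc1 hPT) S hsel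

end Summit.BirchSwinnertonDyer.BirchSwinnertonDyer.Theorems.AdditiveKoly

end
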